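import Summits.QuantumFields.BalabanUV.Beta.GAN24.E3UnitSplitLevels
import Summits.QuantumFields.BalabanUV.Beta.GAN24.OffDiagSandwichSum
import Summits.QuantumFields.BalabanUV.Beta.GAN24.TaylorRowVSupport
import Summits.QuantumFields.BalabanUV.Beta.GAN24.StencilSlotE3PhiLeg
import Summits.QuantumFields.BalabanUV.Beta.GAN24.StencilSlotE3HLeg

/-!
# `BalabanUV.Beta.GAN24.TaylorRowV` — binder row G-an2-4 / (CONV-C), S-slot, road «S3-Taylor» (gan24-p1 `SKELETON-S3.md` v1.2 §16 / RULINGS-7;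
# typer `LEAVES.md` v3.1 PART III row **S3-V**, holder `b2b-balaban-gan24-formalise-leaf-14-g18`, INTENT «ROW-V*» journal l.4689): ROW V, part 2 —
# THE PUSHED (V-H) INCREMENTS OF THE THIRD JET ARE `O(Lc^{−2}·(Lc⁻¹)^{n−m})` BY ABSOLUTE BOUNDS: the hypothesis `hV` of
# `StencilSlotE3OfPieces.e3Shape_of_pieces` at `d = 3`, PROVED (`rowV_three`, every `Lc ≥ 2`, every colour weight `cVH`)

NOT IN PRINT; OUR PROOF ATTEMPT.  HONEST FRAMING (cell contract, verbatim): «discharging `BetaPertH` makes Bałaban's UV stability UNCONDITIONAL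
— a real constructive-QFT result; it is NOT the continuum limit and NOT the Clay problem.»  HONEST DEPENDENCY (verbatim): «continuum YM on T⁴ ⇐
BetaPertH ∧ nine spine estimates (0/9 proved); BetaPertH ⇐ (D1) ∧ (D4) ∧ CAP+tail; G-an2-4 gates asym, D1 and NE2/3/4.»  [folklore] assembly BY
NAME of: leaf-01's unit split `E3UnitSplit.e3VH_unit_split` (first line), this lineage's OFF-DIAGONAL SANDWICH ENGINE
(`OffDiagSandwichSum.sum_abs_channel_le_row` ∕ `_col` over `OffDiagSandwich`: supports keyed to the vertex location, VH1's ROW-form masses), VH1 (`TaylorMassVHPush`),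
road P1's `Φ̃` legs (`StencilSlotE3PhiLeg.phiLeg_three`) and part 1 (`TaylorRowVSupport`).  0 `def`, 0 cite, 0 `def … : Prop`, 0 sorry.  The statement
proved is ONE hypothesis (`hV`, 1 of 12 rows) of the row owner's END; it discharges nothing else of «E3Shape»/«E3SupRate», (hS, hSall), (hW, hWall),
window, (D1); NOT BetaPertH, NOT continuum, NOT Clay.

## What is proved ([folklore]; part `§2` generic `d`, `Lc ≥ 1`; `§3` at `d = 3`, `Lc ≥ 2`)
§2 **`abs_entry_le`** (member `m+k+3`, `N = Lc^{m+k+3}`, the border increment of level `m+1` pushed `k+1` times; legs as hypotheses with one block-`ℓ¹`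
   rate `κ`): `|N^{2(d+1)}·e3OfS N (weight • pushSum (Lc^{m+2}) (Lc^{k+1}) (borderInc d Lc (Lc^{m+1}))) (κ′,u′;x′,z′) (inl α) (inl β)|`
   `≤ cV · (Lc⁻¹)^{k+1} · e^{−(κ/2)(|x′−u′|₁+|z′−u′|₁)}`, `cV = 2|cVH|(d+1)³·CH²CΦ·((2R_V+1)^{d+1})²·3ℓ²·e^{κ(2R_V+4(d+1))}·Zl_{d+1}(κ/2)·Lc^{−(d+1)}·Lc^{−2}`
   (channel 1 = `Φ̃` row ∕ `H̃` column, mass over the multiplier site `w` — `sum_abs_channel_le_row`; channel 2 = `G̃` row ∕ `Φ̃` column, mass over the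
   multiplier site `y` — `sum_abs_channel_le_col`; both `O(L·M)` by `count_mul_mass_le`; prefactor by `prefactor_eq`);
   **`rowV_of_legs`**: `∀ m < n, LocStencil (the row-V family VERBATIM) (cV·(Lc⁻¹)^{n−m}) (κ/2)` (other fibre blocks of `e3OfS` vanish).
§3 **`rowV_three_of_legs`** (`d = 3`: the two leg packages in the literal shapes of `StencilSlotE3PhiLeg.phiLeg_three` and `StencilSlotE3HLeg.legs_three`,
   common rate by `OneStepResolventKernel.bound_mono` ⇒ `∃ cV θ δ, 0 ≤ cV ∧ 0 ≤ θ ∧ θ < 1 ∧ 0 < δ ∧ hV`, `θ = Lc⁻¹`), `rowV_three_of_hLegs` (the `Φ̃`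
   package discharged BY NAME) and **`rowV_three`** (both packages BY NAME: `hV` UNCONDITIONAL at `d = 3`, `Lc ≥ 2`).
READING (displayed, not claimed beyond the theorem): ENGINE-B's per-push ratios 1.65–1.90 at `Lc = 2` (journal l.4544) vs the proved `θ = Lc⁻¹ = 0.5`
ratio bound `2` — consistent.
-/

noncomputable section

open Finset
open scoped BigOperators
open Literature.MathematicalPhysics.QuantumFieldTheory
open Literature.MathematicalPhysics.QuantumFieldTheory.Balaban1983to89
open Literature.MathematicalPhysics.QuantumFieldTheory.Balaban1983to89.Beta
open LatticeForm (quo)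
open B12Sec2to5 (l1 l1_nonneg)
open ExpKernelCalculus (MKer Zl Zl_pos l1_sub_symm)
open KernelSpecInstance (wH)
open KKTFluctuationKernel (GamΦ)
open OneStepResolventKernel (Fib LocStencil KInv)
open AveragingHessianKernels (ell)
open BalabanCompositeJets (pushSum borderInc)
open Summit.QuantumFields.BalabanUV.Beta.GAN24.E3UnitSplit (e3OfS e3OfS_inl_inr e3OfS_inr e3VH_unit_split)
open Summit.QuantumFields.BalabanUV.Beta.GAN24.TaylorMassVHPush (sum_abs_pushSum_borderInc_inl_inr_le
  sum_abs_pushSum_borderInc_inr_inl_le pushSum_borderInc_inl_inr_ne_zero)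
open Summit.QuantumFields.BalabanUV.Beta.GAN24.OffDiagSandwich (const_nonneg_of_dom)
open Summit.QuantumFields.BalabanUV.Beta.GAN24.OffDiagSandwichSum (sum_abs_channel_le_col sum_abs_channel_le_row)
open Summit.QuantumFields.BalabanUV.Beta.GAN24.TaylorRowVSupport

namespace Summit.QuantumFields.BalabanUV.Beta.GAN24.TaylorRowV

variable {d : ℕ} {Lc : ℕ} [NeZero Lc]

/-! ## §2 Row V from leg bounds (generic `d`): the entry estimate and the `LocStencil` packaging -/

section Legs

variable {κ CΦ CH : ℝ}

/-- **THE ENTRY ESTIMATE OF ROW V FROM THE LEG BOUNDS** [folklore] (generic `d`, `Lc ≥ 1`; member `m+k+3`, `N = Lc^{m+k+3}`, the border increment of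
level `m+1` pushed `k+1` times).  Hypotheses: the normalised `mm` legs `Φ̃` in both literal positions (shapes of `StencilSlotE3PhiLeg.phiLeg_three`), the
normalised minimiser legs `H̃ = N^{d+2}·wH` (vertex position) and `G̃ = N^{d+2}·GamΦ` (shapes of `StencilSlotE3HLeg.legs_three`), one common block-`ℓ¹` rate
`κ > 0`.  Conclusion: the `(inl α, inl β)` entry of `N^{2(d+1)}·e3OfS N (weight • pushSum (Lc^{m+2}) (Lc^{k+1}) (borderInc d Lc (Lc^{m+1})))` at
`(κ′, u′; x′, z′)` is at most
`2·|cVH|·(d+1)³·CH²·CΦ·((2R_V+1)^{d+1})²·3ℓ²·e^{κ(2R_V+4(d+1))}·Zl_{d+1}(κ/2)·Lc^{−(d+1)}·Lc^{−2} · (Lc⁻¹)^{k+1} · e^{−(κ/2)(|x′−u′|₁+|z′−u′|₁)}`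
(`R_V = 2(d+1)(Lc+1)+2d+3`): the unit split `E3UnitSplit.e3VH_unit_split`, the two channels by `OffDiagSandwich.sum_abs_channel_le_row` /
`sum_abs_channel_le_col` with VH1's ROW-form masses and supports keyed to the vertex location, the prefactor by `prefactor_eq`.  NO cancellation. -/
theorem abs_entry_le (hL : 1 ≤ Lc) (hκ : 0 < κ)
    (hΦ₁ : ∀ (j : ℕ) (x' w : Fin (d + 1) → ℤ) (α β : Fin (d + 1)),
      |((Lc : ℝ) ^ (j + 1)) ^ (2 * (d + 1)) *
          KInv (N := Lc ^ (j + 1)) (d := d) (((Lc ^ (j + 1) : ℕ) : ℤ) • x') w (Sum.inr α) (Sum.inr β)| ≤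
        CΦ * Real.exp (-κ * l1 (x' - quo (Lc ^ (j + 1)) w)))
    (hΦ₂ : ∀ (j : ℕ) (y z' : Fin (d + 1) → ℤ) (α β : Fin (d + 1)),
      |((Lc : ℝ) ^ (j + 1)) ^ (2 * (d + 1)) *
          KInv (N := Lc ^ (j + 1)) (d := d) y (((Lc ^ (j + 1) : ℕ) : ℤ) • z') (Sum.inr α) (Sum.inr β)| ≤
        CΦ * Real.exp (-κ * l1 (quo (Lc ^ (j + 1)) y - z')))
    (hH : ∀ (j : ℕ) (k l : Fin (d + 1)) (u u' : Fin (d + 1) → ℤ),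
      |((Lc : ℝ) ^ (j + 1)) ^ (d + 2) * wH (N := Lc ^ (j + 1)) k l (u - (((Lc ^ (j + 1) : ℕ) : ℤ)) • u')| ≤
        CH * Real.exp (-κ * l1 (quo (Lc ^ (j + 1)) u - u')))
    (hG : ∀ (j : ℕ) (α l : Fin (d + 1)) (x' w : Fin (d + 1) → ℤ),
      |((Lc : ℝ) ^ (j + 1)) ^ (d + 2) * GamΦ (N := Lc ^ (j + 1)) α x' l w| ≤
        CH * Real.exp (-κ * l1 (x' - quo (Lc ^ (j + 1)) w)))
    (cVH : ℝ) (m k : ℕ) (κ' : Fin (d + 1)) (u' x' z' : Fin (d + 1) → ℤ) (α β : Fin (d + 1)) :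
    |((Lc : ℝ) ^ (m + k + 1 + 1 + 1)) ^ (2 * (d + 1)) *
        e3OfS (Lc ^ (m + k + 1 + 1 + 1))
          (fun κ u => (((Lc : ℝ) ^ (d + 1)) ^ (k + 1) * (cVH * ((Lc : ℝ) ^ (m + 1)) ^ (d + 2))) •
            pushSum (Lc ^ (m + 1 + 1)) (Lc ^ (k + 1)) (borderInc d Lc (Lc ^ (m + 1)) κ u)) κ' u' x' z' (Sum.inl α) (Sum.inl β)| ≤
      (2 * |cVH| * ((d : ℝ) + 1) ^ 3 * (CH * CH * CΦ) *
          (((((2 * (2 * (d + 1) * (Lc + 1) + (2 * d + 3)) + 1) ^ (d + 1) : ℕ) : ℝ)) ^ 2 * (3 * (ell (d + 1) Lc : ℝ) ^ 2)) *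
          Real.exp (κ * (2 * ((2 * (d + 1) * (Lc + 1) + (2 * d + 3) : ℕ) : ℝ) + 4 * ((d : ℝ) + 1))) *
          Zl (d + 1) (κ / 2) * (((Lc : ℝ) ^ (d + 1))⁻¹ * ((Lc : ℝ) ^ 2)⁻¹)) *
        ((Lc : ℝ)⁻¹) ^ (k + 1) * Real.exp (-(κ / 2) * (l1 (x' - u') + l1 (z' - u'))) := by
  -- (0) constants and abbreviations
  have hLpos : (0 : ℝ) < Lc := by exact_mod_cast Nat.lt_of_lt_of_le Nat.zero_lt_one hL
  have hCΦ : 0 ≤ CΦ := const_nonneg_of_dom (hΦ₂ 0 0 0 0 0)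
  have hCH : 0 ≤ CH := const_nonneg_of_dom (hH 0 0 0 0 0)
  set p : ℕ := m + k + 1 + 1 + 1 with hp
  set R : ℕ := 2 * (d + 1) * (Lc + 1) + (2 * d + 3) with hR
  set r₁ : ℕ := R * Lc ^ (m + 1) with hr₁
  set r₂ : ℕ := R * Lc ^ (m + 1) + 2 * (d + 1) * Lc ^ (k + 1) * (Lc ^ (m + 1) * Lc) with hr₂
  set mT : ℝ := ((Lc ^ (k + 1) : ℕ) : ℝ) * ((((2 * R + 1) ^ (d + 1) : ℕ) : ℝ) *
    ((((Lc ^ (m + 1) : ℕ) : ℝ)) * (3 * (ell (d + 1) Lc : ℝ) ^ 2 / (((Lc ^ (m + 1) : ℕ) : ℝ)) ^ (d + 1)))) with hmT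
  -- (1) the unit split
  rw [e3VH_unit_split (Lc := Lc) cVH (m + 1) (k + 1) p (by rw [hp]; ring) κ' u' x' z' α β, abs_mul]
  -- (2) the legs of this member
  have hc : ((((Lc : ℝ) ^ p) ^ (d + 1))⁻¹) = ((((Lc ^ p : ℕ) : ℝ)) ^ (d + 1))⁻¹ := by push_cast; rfl
  have hmass₂ : ∀ (kk : Fin (d + 1)) (u w : Fin (d + 1) → ℤ) (l l' : Fin (d + 1)) (Y : Finset (Fin (d + 1) → ℤ)),
      ∑ y ∈ Y, |pushSum (Lc ^ (m + 1 + 1)) (Lc ^ (k + 1)) (borderInc d Lc (Lc ^ (m + 1)) kk u) w y (Sum.inl l) (Sum.inr l')| ≤ mT := by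
    intro kk u w l l' Y
    have h := sum_abs_pushSum_borderInc_inl_inr_le (Lc ^ (m + 1)) (Lc ^ (k + 1)) hL kk u w l l' Y
    rw [← pow_succ] at h
    exact h
  have hmass₁ : ∀ (kk : Fin (d + 1)) (u y : Fin (d + 1) → ℤ) (l l' : Fin (d + 1)) (W : Finset (Fin (d + 1) → ℤ)),
      ∑ w ∈ W, |pushSum (Lc ^ (m + 1 + 1)) (Lc ^ (k + 1)) (borderInc d Lc (Lc ^ (m + 1)) kk u) w y (Sum.inr l) (Sum.inl l')| ≤ mT := by
    intro kk u y l l' W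
    have h := sum_abs_pushSum_borderInc_inr_inl_le (Lc ^ (m + 1)) (Lc ^ (k + 1)) hL kk u y l l' W
    rw [← pow_succ] at h
    exact h
  have hr₂cast : (((R * Lc ^ (m + 1) : ℕ) : ℝ)) + 2 * ((d : ℝ) + 1) * ((Lc ^ (k + 1) : ℕ) : ℝ) * ((Lc ^ (m + 1) * Lc : ℕ) : ℝ) =
      ((r₂ : ℕ) : ℝ) := by
    rw [hr₂]; push_cast; ring
  have hsupp₂ : ∀ (kk : Fin (d + 1)) (u w y : Fin (d + 1) → ℤ) (l l' : Fin (d + 1)),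
      pushSum (Lc ^ (m + 1 + 1)) (Lc ^ (k + 1)) (borderInc d Lc (Lc ^ (m + 1)) kk u) w y (Sum.inl l) (Sum.inr l') ≠ 0 →
        l1 (w - u) ≤ r₁ ∧ l1 (y - u) ≤ r₂ := by
    intro kk u w y l l' hne
    have h := pushSum_borderInc_inl_inr_ne_zero (Lc ^ (m + 1)) (Lc ^ (k + 1)) hL (by rw [← pow_succ]; exact hne)
    refine ⟨h.2.1, ?_⟩
    rw [← hr₂cast]; exact h.2.2
  have hsupp₁ : ∀ (kk : Fin (d + 1)) (u w y : Fin (d + 1) → ℤ) (l l' : Fin (d + 1)),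
      pushSum (Lc ^ (m + 1 + 1)) (Lc ^ (k + 1)) (borderInc d Lc (Lc ^ (m + 1)) kk u) w y (Sum.inr l) (Sum.inl l') ≠ 0 →
        l1 (w - u) ≤ r₂ ∧ l1 (y - u) ≤ r₁ := by
    intro kk u w y l l' hne
    have h := pushSum_borderInc_inr_inl_ne_zero (Lc ^ (m + 1)) (Lc ^ (k + 1)) hL (by rw [← pow_succ]; exact hne)
    refine ⟨?_, h.2⟩
    rw [← hr₂cast]; exact h.1
  -- (3) the two channels, partial sums
  set E : ℝ := Real.exp (-(κ / 2) * (l1 (x' - u') + l1 (z' - u'))) with hE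
  set Bnd : ℝ := (Fintype.card (Fin (d + 1)) : ℝ) ^ 3 * (CH * CH * CΦ * mT) * (2 * r₁ + 1 : ℝ) ^ (d + 1) *
    Real.exp (κ * (((r₁ : ℝ) + r₂) / ((Lc ^ p : ℕ) : ℝ) + 2 * ((d + 1 : ℕ) : ℝ))) * (Zl (d + 1) (κ / 2) * E) with hBnd
  have h1 : ∀ Y : Finset (Fin (d + 1) → ℤ), ∑ y ∈ Y, |∑ l' : Fin (d + 1),
      (∑' w : Fin (d + 1) → ℤ, ∑ l : Fin (d + 1),
          (((Lc : ℝ) ^ p) ^ (2 * (d + 1)) * KInv (N := Lc ^ p) (d := d) (((Lc ^ p : ℕ) : ℤ) • x') w (Sum.inr α) (Sum.inr l)) *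
          ∑ κ'' : Fin (d + 1), (((Lc : ℝ) ^ p) ^ (d + 1))⁻¹ * ∑' u : Fin (d + 1) → ℤ,
            (((Lc : ℝ) ^ p) ^ (d + 2) * wH (N := Lc ^ p) κ'' κ' (u - ((Lc ^ p : ℕ) : ℤ) • u')) *
              pushSum (Lc ^ (m + 1 + 1)) (Lc ^ (k + 1)) (borderInc d Lc (Lc ^ (m + 1)) κ'' u) w y (Sum.inr l) (Sum.inl l')) *
        (((Lc : ℝ) ^ p) ^ (d + 2) * wH (N := Lc ^ p) l' β (y - ((Lc ^ p : ℕ) : ℤ) • z'))| ≤ Bnd := by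
    intro Y
    have h := sum_abs_channel_le_row (ι := Fin (d + 1)) (D := d + 1) (Lc ^ p)
      (fun l w => ((Lc : ℝ) ^ p) ^ (2 * (d + 1)) * KInv (N := Lc ^ p) (d := d) (((Lc ^ p : ℕ) : ℤ) • x') w (Sum.inr α) (Sum.inr l))
      (fun κ'' u => ((Lc : ℝ) ^ p) ^ (d + 2) * wH (N := Lc ^ p) κ'' κ' (u - ((Lc ^ p : ℕ) : ℤ) • u'))
      (fun l' y => ((Lc : ℝ) ^ p) ^ (d + 2) * wH (N := Lc ^ p) l' β (y - ((Lc ^ p : ℕ) : ℤ) • z'))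
      (fun κ'' u w y l l' => pushSum (Lc ^ (m + 1 + 1)) (Lc ^ (k + 1)) (borderInc d Lc (Lc ^ (m + 1)) κ'' u) w y (Sum.inr l) (Sum.inl l'))
      ((((Lc : ℝ) ^ p) ^ (d + 1))⁻¹) hc x' u' z' hκ
      (fun l w => by rw [l1_sub_symm]; exact hΦ₁ (m + k + 1 + 1) x' w α l)
      (fun κ'' u => hH (m + k + 1 + 1) κ'' κ' u u')
      (fun l' y => hH (m + k + 1 + 1) l' β y z')
      hmass₁ hsupp₁ Y
    refine h.trans (le_of_eq ?_)
    rw [hBnd, add_comm (l1 (z' - u')) (l1 (x' - u'))]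
  have h2 : ∀ Y : Finset (Fin (d + 1) → ℤ), ∑ y ∈ Y, |∑ l' : Fin (d + 1),
      (∑' w : Fin (d + 1) → ℤ, ∑ l : Fin (d + 1),
          (((Lc : ℝ) ^ p) ^ (d + 2) * GamΦ (N := Lc ^ p) α x' l w) *
          ∑ κ'' : Fin (d + 1), (((Lc : ℝ) ^ p) ^ (d + 1))⁻¹ * ∑' u : Fin (d + 1) → ℤ,
            (((Lc : ℝ) ^ p) ^ (d + 2) * wH (N := Lc ^ p) κ'' κ' (u - ((Lc ^ p : ℕ) : ℤ) • u')) *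
              pushSum (Lc ^ (m + 1 + 1)) (Lc ^ (k + 1)) (borderInc d Lc (Lc ^ (m + 1)) κ'' u) w y (Sum.inl l) (Sum.inr l')) *
        (((Lc : ℝ) ^ p) ^ (2 * (d + 1)) *
          KInv (N := Lc ^ p) (d := d) y (((Lc ^ p : ℕ) : ℤ) • z') (Sum.inr l') (Sum.inr β))| ≤ Bnd := by
    intro Y
    have h := sum_abs_channel_le_col (ι := Fin (d + 1)) (D := d + 1) (Lc ^ p)
      (fun l w => ((Lc : ℝ) ^ p) ^ (d + 2) * GamΦ (N := Lc ^ p) α x' l w)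
      (fun κ'' u => ((Lc : ℝ) ^ p) ^ (d + 2) * wH (N := Lc ^ p) κ'' κ' (u - ((Lc ^ p : ℕ) : ℤ) • u'))
      (fun l' y => ((Lc : ℝ) ^ p) ^ (2 * (d + 1)) * KInv (N := Lc ^ p) (d := d) y (((Lc ^ p : ℕ) : ℤ) • z') (Sum.inr l') (Sum.inr β))
      (fun κ'' u w y l l' => pushSum (Lc ^ (m + 1 + 1)) (Lc ^ (k + 1)) (borderInc d Lc (Lc ^ (m + 1)) κ'' u) w y (Sum.inl l) (Sum.inr l'))
      ((((Lc : ℝ) ^ p) ^ (d + 1))⁻¹) hc x' u' z' hκ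
      (fun l w => by rw [l1_sub_symm]; exact hG (m + k + 1 + 1) α l x' w)
      (fun κ'' u => hH (m + k + 1 + 1) κ'' κ' u u')
      (fun l' y => hΦ₂ (m + k + 1 + 1) y z' l' β)
      hmass₂ hsupp₂ Y
    refine h.trans (le_of_eq ?_)
    rw [hBnd]
  have hS := abs_tsum_add_le_of_sum_abs_le h1 h2
  -- (4) the constant `Bnd` against the explicit `L·M`-form
  have hcard : (Fintype.card (Fin (d + 1)) : ℝ) = (d : ℝ) + 1 := by simp
  have hexp : Real.exp (κ * (((r₁ : ℝ) + r₂) / ((Lc ^ p : ℕ) : ℝ) + 2 * ((d + 1 : ℕ) : ℝ))) ≤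
      Real.exp (κ * (2 * (R : ℝ) + 4 * ((d : ℝ) + 1))) := by
    refine Real.exp_le_exp.2 (mul_le_mul_of_nonneg_left ?_ hκ.le)
    have hrad := radii_div_le (d := d) hL R m k
    rw [← hr₁, ← hr₂, ← hp] at hrad
    push_cast at hrad ⊢
    linarith
  have hcm : (2 * (r₁ : ℝ) + 1) ^ (d + 1) * mT ≤
      ((((2 * R + 1) ^ (d + 1) : ℕ) : ℝ)) ^ 2 * (3 * (ell (d + 1) Lc : ℝ) ^ 2) * (Lc : ℝ) ^ (k + 1) * (Lc : ℝ) ^ (m + 1) := by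
    have h := count_mul_mass_le (d := d) hL R (ell (d + 1) Lc : ℝ) m k
    rw [hr₁, hmT]
    exact h
  have hE0 : 0 ≤ E := (Real.exp_pos _).le
  have hZ : 0 ≤ Zl (d + 1) (κ / 2) := (Zl_pos (half_pos hκ)).le
  have hBnd_le : Bnd ≤ ((d : ℝ) + 1) ^ 3 * (CH * CH * CΦ) *
      (((((2 * R + 1) ^ (d + 1) : ℕ) : ℝ)) ^ 2 * (3 * (ell (d + 1) Lc : ℝ) ^ 2) * (Lc : ℝ) ^ (k + 1) * (Lc : ℝ) ^ (m + 1)) *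
      Real.exp (κ * (2 * (R : ℝ) + 4 * ((d : ℝ) + 1))) * (Zl (d + 1) (κ / 2) * E) := by
    rw [hBnd, hcard]
    have e1 : ((d : ℝ) + 1) ^ 3 * (CH * CH * CΦ * mT) * (2 * (r₁ : ℝ) + 1) ^ (d + 1) =
        ((d : ℝ) + 1) ^ 3 * (CH * CH * CΦ) * ((2 * (r₁ : ℝ) + 1) ^ (d + 1) * mT) := by ring
    rw [e1]
    have hA0 : 0 ≤ ((d : ℝ) + 1) ^ 3 * (CH * CH * CΦ) := by positivity
    exact mul_le_mul (mul_le_mul (mul_le_mul_of_nonneg_left hcm hA0) hexp (Real.exp_pos _).le (by positivity)) le_rfl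
      (by positivity) (by positivity)
  -- (5) assemble
  have hPF : |-(cVH / (Lc : ℝ) ^ (d + 1)) * ((Lc : ℝ) ^ p) ^ (-(2 : ℤ)) * (Lc : ℝ) ^ (m + 1)| =
      |cVH| * ((Lc : ℝ) ^ (d + 1))⁻¹ * (((Lc : ℝ) ^ p) ^ (-(2 : ℤ)) * (Lc : ℝ) ^ (m + 1)) := by
    rw [abs_mul, abs_mul, abs_neg, abs_div, abs_of_pos (pow_pos hLpos _), abs_of_pos (zpow_pos (pow_pos hLpos _) _),
      abs_of_pos (pow_pos hLpos _)]
    ring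
  have hpre := prefactor_eq (Lc := Lc) hL m k
  rw [← hp] at hpre
  calc |-(cVH / (Lc : ℝ) ^ (d + 1)) * ((Lc : ℝ) ^ p) ^ (-(2 : ℤ)) * (Lc : ℝ) ^ (m + 1)| * _
      ≤ |-(cVH / (Lc : ℝ) ^ (d + 1)) * ((Lc : ℝ) ^ p) ^ (-(2 : ℤ)) * (Lc : ℝ) ^ (m + 1)| * (Bnd + Bnd) :=
        mul_le_mul_of_nonneg_left hS (abs_nonneg _)
    _ ≤ |cVH| * ((Lc : ℝ) ^ (d + 1))⁻¹ * (((Lc : ℝ) ^ p) ^ (-(2 : ℤ)) * (Lc : ℝ) ^ (m + 1)) *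
        (2 * (((d : ℝ) + 1) ^ 3 * (CH * CH * CΦ) *
          (((((2 * R + 1) ^ (d + 1) : ℕ) : ℝ)) ^ 2 * (3 * (ell (d + 1) Lc : ℝ) ^ 2) * (Lc : ℝ) ^ (k + 1) * (Lc : ℝ) ^ (m + 1)) *
          Real.exp (κ * (2 * (R : ℝ) + 4 * ((d : ℝ) + 1))) * (Zl (d + 1) (κ / 2) * E))) := by
        rw [hPF, ← two_mul]
        exact mul_le_mul_of_nonneg_left (mul_le_mul_of_nonneg_left hBnd_le (by norm_num)) (by positivity)
    _ = (2 * |cVH| * ((d : ℝ) + 1) ^ 3 * (CH * CH * CΦ) *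
          (((((2 * R + 1) ^ (d + 1) : ℕ) : ℝ)) ^ 2 * (3 * (ell (d + 1) Lc : ℝ) ^ 2)) *
          Real.exp (κ * (2 * (R : ℝ) + 4 * ((d : ℝ) + 1))) *
          Zl (d + 1) (κ / 2) * (((Lc : ℝ) ^ (d + 1))⁻¹ * ((Lc : ℝ) ^ 2)⁻¹)) *
        ((Lc : ℝ)⁻¹) ^ (k + 1) * E := by
        have e2 : ((Lc : ℝ) ^ p) ^ (-(2 : ℤ)) * (Lc : ℝ) ^ (m + 1) * ((Lc : ℝ) ^ (k + 1) * (Lc : ℝ) ^ (m + 1)) =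
            ((Lc : ℝ) ^ 2)⁻¹ * ((Lc : ℝ)⁻¹) ^ (k + 1) := hpre
        calc |cVH| * ((Lc : ℝ) ^ (d + 1))⁻¹ * (((Lc : ℝ) ^ p) ^ (-(2 : ℤ)) * (Lc : ℝ) ^ (m + 1)) *
              (2 * (((d : ℝ) + 1) ^ 3 * (CH * CH * CΦ) *
                (((((2 * R + 1) ^ (d + 1) : ℕ) : ℝ)) ^ 2 * (3 * (ell (d + 1) Lc : ℝ) ^ 2) * (Lc : ℝ) ^ (k + 1) * (Lc : ℝ) ^ (m + 1)) *
                Real.exp (κ * (2 * (R : ℝ) + 4 * ((d : ℝ) + 1))) * (Zl (d + 1) (κ / 2) * E)))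
            = |cVH| * ((Lc : ℝ) ^ (d + 1))⁻¹ *
              (((Lc : ℝ) ^ p) ^ (-(2 : ℤ)) * (Lc : ℝ) ^ (m + 1) * ((Lc : ℝ) ^ (k + 1) * (Lc : ℝ) ^ (m + 1))) *
              (2 * (((d : ℝ) + 1) ^ 3 * (CH * CH * CΦ) *
                (((((2 * R + 1) ^ (d + 1) : ℕ) : ℝ)) ^ 2 * (3 * (ell (d + 1) Lc : ℝ) ^ 2)) *
                Real.exp (κ * (2 * (R : ℝ) + 4 * ((d : ℝ) + 1))) * (Zl (d + 1) (κ / 2) * E))) := by ring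
          _ = _ := by rw [e2]; ring


/-- **ROW V FROM THE LEG BOUNDS — THE `LocStencil` FORM** [folklore] (generic `d`, `Lc ≥ 1`): for all `m < n`, the family
`(κ′, u′) ↦ N^{2(d+1)}·e3OfS N ((c^{n−m}·cVH·M^{d+2}) • pushSum (Lc^{m+2}) (Lc^{n−m}) (borderInc d Lc M))`, `N = Lc^{n+2}`, `M = Lc^{m+1}`, `c = Lc^{d+1}` —
VERBATIM the argument of the hypothesis `hV` of `StencilSlotE3OfPieces.e3Shape_of_pieces` — is a `LocStencil` with constant `cV·(Lc⁻¹)^{n−m}` and rate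
`κ/2`, `cV` the explicit `n,m`-free constant of `abs_entry_le`.  The off-diagonal and multiplier-row blocks of `e3OfS` vanish
(`E3UnitSplit.e3OfS_inl_inr`, `e3OfS_inr`). -/
theorem rowV_of_legs (hL : 1 ≤ Lc) (hκ : 0 < κ)
    (hΦ₁ : ∀ (j : ℕ) (x' w : Fin (d + 1) → ℤ) (α β : Fin (d + 1)),
      |((Lc : ℝ) ^ (j + 1)) ^ (2 * (d + 1)) *
          KInv (N := Lc ^ (j + 1)) (d := d) (((Lc ^ (j + 1) : ℕ) : ℤ) • x') w (Sum.inr α) (Sum.inr β)| ≤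
        CΦ * Real.exp (-κ * l1 (x' - quo (Lc ^ (j + 1)) w)))
    (hΦ₂ : ∀ (j : ℕ) (y z' : Fin (d + 1) → ℤ) (α β : Fin (d + 1)),
      |((Lc : ℝ) ^ (j + 1)) ^ (2 * (d + 1)) *
          KInv (N := Lc ^ (j + 1)) (d := d) y (((Lc ^ (j + 1) : ℕ) : ℤ) • z') (Sum.inr α) (Sum.inr β)| ≤
        CΦ * Real.exp (-κ * l1 (quo (Lc ^ (j + 1)) y - z')))
    (hH : ∀ (j : ℕ) (k l : Fin (d + 1)) (u u' : Fin (d + 1) → ℤ),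
      |((Lc : ℝ) ^ (j + 1)) ^ (d + 2) * wH (N := Lc ^ (j + 1)) k l (u - (((Lc ^ (j + 1) : ℕ) : ℤ)) • u')| ≤
        CH * Real.exp (-κ * l1 (quo (Lc ^ (j + 1)) u - u')))
    (hG : ∀ (j : ℕ) (α l : Fin (d + 1)) (x' w : Fin (d + 1) → ℤ),
      |((Lc : ℝ) ^ (j + 1)) ^ (d + 2) * GamΦ (N := Lc ^ (j + 1)) α x' l w| ≤
        CH * Real.exp (-κ * l1 (x' - quo (Lc ^ (j + 1)) w)))
    (cVH : ℝ) (n m : ℕ) (hmn : m < n) :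
    LocStencil (fun κ' u' x' z' a b => ((Lc : ℝ) ^ (n + 1 + 1)) ^ (2 * (d + 1)) *
      e3OfS (Lc ^ (n + 1 + 1)) (fun κ u => (((Lc : ℝ) ^ (d + 1)) ^ (n - m) * (cVH * ((Lc : ℝ) ^ (m + 1)) ^ (d + 2))) •
        pushSum (Lc ^ (m + 1 + 1)) (Lc ^ (n - m)) (borderInc d Lc (Lc ^ (m + 1)) κ u)) κ' u' x' z' a b)
      ((2 * |cVH| * ((d : ℝ) + 1) ^ 3 * (CH * CH * CΦ) *
          (((((2 * (2 * (d + 1) * (Lc + 1) + (2 * d + 3)) + 1) ^ (d + 1) : ℕ) : ℝ)) ^ 2 * (3 * (ell (d + 1) Lc : ℝ) ^ 2)) *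
          Real.exp (κ * (2 * ((2 * (d + 1) * (Lc + 1) + (2 * d + 3) : ℕ) : ℝ) + 4 * ((d : ℝ) + 1))) *
          Zl (d + 1) (κ / 2) * (((Lc : ℝ) ^ (d + 1))⁻¹ * ((Lc : ℝ) ^ 2)⁻¹)) * ((Lc : ℝ)⁻¹) ^ (n - m))
      (κ / 2) := by
  have hLpos : (0 : ℝ) < Lc := by exact_mod_cast Nat.lt_of_lt_of_le Nat.zero_lt_one hL
  have hCΦ : 0 ≤ CΦ := const_nonneg_of_dom (hΦ₂ 0 0 0 0 0)
  have hCH : 0 ≤ CH := const_nonneg_of_dom (hH 0 0 0 0 0)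
  have hZ : 0 < Zl (d + 1) (κ / 2) := Zl_pos (half_pos hκ)
  obtain ⟨k, rfl⟩ := Nat.exists_eq_add_of_lt hmn
  have ek : m + k + 1 - m = k + 1 := by omega
  rw [ek]
  intro κ' u' x' z' a b
  dsimp only
  rcases a with α | μ
  · rcases b with β | ν
    · exact abs_entry_le hL hκ hΦ₁ hΦ₂ hH hG cVH m k κ' u' x' z' α β
    · rw [e3OfS_inl_inr, mul_zero, abs_zero]
      positivity
  · rw [e3OfS_inr, mul_zero, abs_zero]
    positivity

end Legs

/-! ## §3 `d = 3`: row V from the two leg packages (`StencilSlotE3PhiLeg.phiLeg_three`, `StencilSlotE3HLeg.legs_three`) -/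

/-- **ROW V AT `d = 3` FROM THE TWO LEG PACKAGES** [folklore] (`Lc ≥ 2`): given the `Φ̃`-leg package in the literal shape of
`StencilSlotE3PhiLeg.phiLeg_three` (a tree theorem: road P1's K-slot) and the `H̃`/`G̃`-leg package in the literal shape of
`StencilSlotE3HLeg.legs_three` (leaf-16's (N1) `FineReadoutDecay.exists_wH_decay` re-currencied), there are `cV ≥ 0`, `θ = Lc⁻¹ ∈ [0,1)` and `δ > 0` with
`hV`: `∀ m < n, LocStencil (member n+2, the border increment of level m+1 pushed n−m times, natural weight) (cV·θ^{n−m}) δ` — the hypothesis `hV` of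
`StencilSlotE3OfPieces.e3Shape_of_pieces` at `d = 3`, fully specialised. -/
theorem rowV_three_of_legs (hLc : 2 ≤ Lc) (cVH : ℝ)
    (hΦ : ∃ C δ : ℝ, 0 < δ ∧ 0 ≤ C ∧
      (∀ (j : ℕ) (x' w : Fin (3 + 1) → ℤ) (α β : Fin (3 + 1)),
        |((Lc : ℝ) ^ (j + 1)) ^ (2 * (3 + 1)) *
            KInv (N := Lc ^ (j + 1)) (d := 3) (((Lc ^ (j + 1) : ℕ) : ℤ) • x') w (Sum.inr α) (Sum.inr β)| ≤
          C * Real.exp (-δ * l1 (x' - quo (Lc ^ (j + 1)) w))) ∧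
      (∀ (j : ℕ) (y z' : Fin (3 + 1) → ℤ) (α β : Fin (3 + 1)),
        |((Lc : ℝ) ^ (j + 1)) ^ (2 * (3 + 1)) *
            KInv (N := Lc ^ (j + 1)) (d := 3) y (((Lc ^ (j + 1) : ℕ) : ℤ) • z') (Sum.inr α) (Sum.inr β)| ≤
          C * Real.exp (-δ * l1 (quo (Lc ^ (j + 1)) y - z'))))
    (hHG : ∃ C κ : ℝ, 0 < κ ∧ 0 ≤ C ∧
      (∀ (j : ℕ) (k l : Fin (3 + 1)) (u u' : Fin (3 + 1) → ℤ),
        |((Lc : ℝ) ^ (j + 1)) ^ (3 + 2) * wH (N := Lc ^ (j + 1)) k l (u - (((Lc ^ (j + 1) : ℕ) : ℤ)) • u')| ≤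
          C * Real.exp (-κ * l1 (quo (Lc ^ (j + 1)) u - u'))) ∧
      (∀ (j : ℕ) (α l : Fin (3 + 1)) (x' w : Fin (3 + 1) → ℤ),
        |((Lc : ℝ) ^ (j + 1)) ^ (3 + 2) * GamΦ (N := Lc ^ (j + 1)) α x' l w| ≤
          C * Real.exp (-κ * l1 (x' - quo (Lc ^ (j + 1)) w)))) :
    ∃ cV θ δ : ℝ, 0 ≤ cV ∧ 0 ≤ θ ∧ θ < 1 ∧ 0 < δ ∧ ∀ n m : ℕ, m < n →
      LocStencil (fun κ' u' x' z' a b => ((Lc : ℝ) ^ (n + 1 + 1)) ^ (2 * (3 + 1)) *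
        e3OfS (Lc ^ (n + 1 + 1)) (fun κ u => (((Lc : ℝ) ^ (3 + 1)) ^ (n - m) * (cVH * ((Lc : ℝ) ^ (m + 1)) ^ (3 + 2))) •
          pushSum (Lc ^ (m + 1 + 1)) (Lc ^ (n - m)) (borderInc 3 Lc (Lc ^ (m + 1)) κ u)) κ' u' x' z' a b) (cV * θ ^ (n - m)) δ := by
  obtain ⟨CΦ, δΦ, hδΦ, hCΦ, hΦ₁, hΦ₂⟩ := hΦ
  obtain ⟨CH, κH, hκH, hCH, hH, hG⟩ := hHG
  have hL : 1 ≤ Lc := le_trans (by norm_num) hLc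
  have hLpos : (0 : ℝ) < Lc := by exact_mod_cast Nat.lt_of_lt_of_le Nat.zero_lt_one hL
  -- common rate
  set κ : ℝ := min δΦ κH with hκdef
  have hκ : 0 < κ := lt_min hδΦ hκH
  have hκΦ : κ ≤ δΦ := min_le_left _ _
  have hκH' : κ ≤ κH := min_le_right _ _
  have hΦ₁' : ∀ (j : ℕ) (x' w : Fin (3 + 1) → ℤ) (α β : Fin (3 + 1)),
      |((Lc : ℝ) ^ (j + 1)) ^ (2 * (3 + 1)) *
          KInv (N := Lc ^ (j + 1)) (d := 3) (((Lc ^ (j + 1) : ℕ) : ℤ) • x') w (Sum.inr α) (Sum.inr β)| ≤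
        CΦ * Real.exp (-κ * l1 (x' - quo (Lc ^ (j + 1)) w)) :=
    fun j x' w α β => OneStepResolventKernel.bound_mono (hΦ₁ j x' w α β) hCΦ le_rfl hκΦ (l1_nonneg _)
  have hΦ₂' : ∀ (j : ℕ) (y z' : Fin (3 + 1) → ℤ) (α β : Fin (3 + 1)),
      |((Lc : ℝ) ^ (j + 1)) ^ (2 * (3 + 1)) *
          KInv (N := Lc ^ (j + 1)) (d := 3) y (((Lc ^ (j + 1) : ℕ) : ℤ) • z') (Sum.inr α) (Sum.inr β)| ≤
        CΦ * Real.exp (-κ * l1 (quo (Lc ^ (j + 1)) y - z')) :=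
    fun j y z' α β => OneStepResolventKernel.bound_mono (hΦ₂ j y z' α β) hCΦ le_rfl hκΦ (l1_nonneg _)
  have hH' : ∀ (j : ℕ) (k l : Fin (3 + 1)) (u u' : Fin (3 + 1) → ℤ),
      |((Lc : ℝ) ^ (j + 1)) ^ (3 + 2) * wH (N := Lc ^ (j + 1)) k l (u - (((Lc ^ (j + 1) : ℕ) : ℤ)) • u')| ≤
        CH * Real.exp (-κ * l1 (quo (Lc ^ (j + 1)) u - u')) :=
    fun j k l u u' => OneStepResolventKernel.bound_mono (hH j k l u u') hCH le_rfl hκH' (l1_nonneg _)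
  have hG' : ∀ (j : ℕ) (α l : Fin (3 + 1)) (x' w : Fin (3 + 1) → ℤ),
      |((Lc : ℝ) ^ (j + 1)) ^ (3 + 2) * GamΦ (N := Lc ^ (j + 1)) α x' l w| ≤
        CH * Real.exp (-κ * l1 (x' - quo (Lc ^ (j + 1)) w)) :=
    fun j α l x' w => OneStepResolventKernel.bound_mono (hG j α l x' w) hCH le_rfl hκH' (l1_nonneg _)
  have hZ : 0 < Zl (3 + 1) (κ / 2) := Zl_pos (half_pos hκ)
  refine ⟨2 * |cVH| * ((3 : ℝ) + 1) ^ 3 * (CH * CH * CΦ) *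
      (((((2 * (2 * (3 + 1) * (Lc + 1) + (2 * 3 + 3)) + 1) ^ (3 + 1) : ℕ) : ℝ)) ^ 2 * (3 * (ell (3 + 1) Lc : ℝ) ^ 2)) *
      Real.exp (κ * (2 * ((2 * (3 + 1) * (Lc + 1) + (2 * 3 + 3) : ℕ) : ℝ) + 4 * ((3 : ℝ) + 1))) *
      Zl (3 + 1) (κ / 2) * (((Lc : ℝ) ^ (3 + 1))⁻¹ * ((Lc : ℝ) ^ 2)⁻¹),
    (Lc : ℝ)⁻¹, κ / 2, by positivity, by positivity, ?_, half_pos hκ, fun n m hmn => ?_⟩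
  · have h2 : (2 : ℝ) ≤ Lc := by exact_mod_cast hLc
    exact inv_lt_one_of_one_lt₀ (by linarith)
  · have h := rowV_of_legs (d := 3) (Lc := Lc) hL hκ hΦ₁' hΦ₂' hH' hG' cVH n m hmn
    simpa only [Nat.cast_ofNat] using h


/-- **ROW V AT `d = 3`, MODULO THE `H̃`/`G̃`-LEG PACKAGE ONLY** [folklore] (`Lc ≥ 2`): the `Φ̃`-legs are discharged BY NAME by road P1's
`StencilSlotE3PhiLeg.phiLeg_three` (unconditional); what remains is exactly the statement of `StencilSlotE3HLeg.legs_three`, i.e. leaf-16's (N1)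
`FineReadoutDecay.exists_wH_decay` in the sandwich currency.  When that module is in the tree, `rowV_three_of_hLegs StencilSlotE3HLeg.legs_three` is `hV`. -/
theorem rowV_three_of_hLegs (hLc : 2 ≤ Lc) (cVH : ℝ)
    (hHG : ∃ C κ : ℝ, 0 < κ ∧ 0 ≤ C ∧
      (∀ (j : ℕ) (k l : Fin (3 + 1)) (u u' : Fin (3 + 1) → ℤ),
        |((Lc : ℝ) ^ (j + 1)) ^ (3 + 2) * wH (N := Lc ^ (j + 1)) k l (u - (((Lc ^ (j + 1) : ℕ) : ℤ)) • u')| ≤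
          C * Real.exp (-κ * l1 (quo (Lc ^ (j + 1)) u - u'))) ∧
      (∀ (j : ℕ) (α l : Fin (3 + 1)) (x' w : Fin (3 + 1) → ℤ),
        |((Lc : ℝ) ^ (j + 1)) ^ (3 + 2) * GamΦ (N := Lc ^ (j + 1)) α x' l w| ≤
          C * Real.exp (-κ * l1 (x' - quo (Lc ^ (j + 1)) w)))) :
    ∃ cV θ δ : ℝ, 0 ≤ cV ∧ 0 ≤ θ ∧ θ < 1 ∧ 0 < δ ∧ ∀ n m : ℕ, m < n →
      LocStencil (fun κ' u' x' z' a b => ((Lc : ℝ) ^ (n + 1 + 1)) ^ (2 * (3 + 1)) *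
        e3OfS (Lc ^ (n + 1 + 1)) (fun κ u => (((Lc : ℝ) ^ (3 + 1)) ^ (n - m) * (cVH * ((Lc : ℝ) ^ (m + 1)) ^ (3 + 2))) •
          pushSum (Lc ^ (m + 1 + 1)) (Lc ^ (n - m)) (borderInc 3 Lc (Lc ^ (m + 1)) κ u)) κ' u' x' z' a b) (cV * θ ^ (n - m)) δ :=
  rowV_three_of_legs hLc cVH StencilSlotE3PhiLeg.phiLeg_three hHG

/-- **ROW V AT `d = 3`, UNCONDITIONAL** (`Lc ≥ 2`; every `cVH : ℝ`): there are `cV ≥ 0`, `θ ∈ [0, 1)` (`= Lc⁻¹`) and `δ > 0` such that for all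
`m < n` the normalised third-jet piece of member `n+2` built on the level-`m+1` border increment pushed `n−m` times is a `LocStencil` with constant
`cV·θ^{n−m}` and rate `δ` — the hypothesis `hV` of `StencilSlotE3OfPieces.e3Shape_of_pieces` at `d = 3` (statement copied from the staged END
2cc3c5eb8d83de1a with `3` substituted).  Inputs BY NAME: road P1's `StencilSlotE3PhiLeg.phiLeg_three` and gan24-p1's `StencilSlotE3HLeg.legs_three`
(leaf-16's (N1) `FineReadoutDecay.exists_wH_decay` inside).  [folklore] assembly; discharges ONE of the twelve S3 rows and nothing else. -/
theorem rowV_three (hLc : 2 ≤ Lc) (cVH : ℝ) :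
    ∃ cV θ δ : ℝ, 0 ≤ cV ∧ 0 ≤ θ ∧ θ < 1 ∧ 0 < δ ∧ ∀ n m : ℕ, m < n →
      LocStencil (fun κ' u' x' z' a b => ((Lc : ℝ) ^ (n + 1 + 1)) ^ (2 * (3 + 1)) *
        e3OfS (Lc ^ (n + 1 + 1)) (fun κ u => (((Lc : ℝ) ^ (3 + 1)) ^ (n - m) * (cVH * ((Lc : ℝ) ^ (m + 1)) ^ (3 + 2))) •
          pushSum (Lc ^ (m + 1 + 1)) (Lc ^ (n - m)) (borderInc 3 Lc (Lc ^ (m + 1)) κ u)) κ' u' x' z' a b) (cV * θ ^ (n - m)) δ :=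
  rowV_three_of_hLegs hLc cVH StencilSlotE3HLeg.legs_three

end Summit.QuantumFields.BalabanUV.Beta.GAN24.TaylorRowV

end
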